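import Literature.NumberTheory.LFunctions.ZetaClassicalRegionBounds
import HarnessLib

/-!
# `|ζ(σ + it) − 1| ≤ ζ(σ) − 1` for `σ > 1` (termwise from the Dirichlet series)

Topic `Literature/NumberTheory/LFunctions`. Everything here is PROVED. For `Re s = σ > 1` the
Dirichlet series `ζ(s) = Σ_{n ≥ 1} n^{-s}` [Titchmarsh1986, §1.1 eq. (1.1.1)] gives, termwise,
`|ζ(s) − 1| = |Σ_{n ≥ 2} n^{-s}| ≤ Σ_{n ≥ 2} n^{-σ} = ζ(σ) − 1`:

* `norm_riemannZeta_sub_one_le_re_sub_one` — `‖ζ(s) − 1‖ ≤ Re ζ(σ) − 1` (`σ = Re s > 1`);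
* `norm_riemannZeta_sub_one_le_norm_sub_one` — `‖ζ(s) − 1‖ ≤ ‖ζ(σ)‖ − 1`;
* `norm_riemannZeta_vertical_sub_one_le` — the vertical-line form
  `‖ζ(σ + it) − 1‖ ≤ ‖ζ(σ)‖ − 1` for all real `σ > 1`, `t` (the support fact `ZetaSubOneVerticalSup`
  of the cell rh-jensen log-band programme, memo TRANSFER-LENS-5 §5, used on the Cauchy arcs right
  of the `1`-line).

Proof pattern: the tree's `ZetaClassicalRegion.norm_LSeries_le_of_norm_le_one`
(`ZetaClassicalRegionBounds.lean`), with the term `n = 1` split off by Mathlib's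
`Summable.tsum_eq_add_tsum_ite`. RH-FREE; nothing here bears on the truth of RH.
AI-produced formalisation (prover-rh-jensen-eng-2-g4-0, 2026-08-26; idea-1 g5 WANTED W3);
AI review is weaker than expert review.

## References
* [Titchmarsh1986] E. C. Titchmarsh, *The Theory of the Riemann Zeta-Function*, 2nd ed., §1.1
  eq. (1.1.1).
-/

noncomputable section

open Complex Filter Topology

namespace Literature.NumberTheory.LFunctions

/-- **`‖ζ(s) − 1‖ ≤ Re ζ(σ) − 1` for `σ = Re s > 1`** (termwise comparison of the Dirichlet series
with the term `n = 1` removed: `‖n^{-s}‖ = n^{-σ}`). [cite: Titchmarsh1986, §1.1 eq. (1.1.1)] -/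
theorem norm_riemannZeta_sub_one_le_re_sub_one {s : ℂ} (hs : 1 < s.re) :
    ‖riemannZeta s - 1‖ ≤ (riemannZeta (s.re : ℂ)).re - 1 := by
  classical
  set σ : ℝ := s.re with hσdef
  have hσ : 1 < (σ : ℂ).re := by simp [hs]
  have hsumf : LSeriesSummable 1 s := LSeriesSummable_one_iff.2 hs
  have hsum1 : LSeriesSummable 1 (σ : ℂ) := LSeriesSummable_one_iff.2 hσ
  -- the term `n = 1` equals `1`
  have ht1 : ∀ z : ℂ, LSeries.term (1 : ℕ → ℂ) z 1 = 1 := fun z => by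
    rw [LSeries.term_of_ne_zero one_ne_zero]; simp
  -- `ζ(s) - 1` and `Re ζ(σ) - 1` as sums over `n ≠ 1`
  have hζ : riemannZeta s - 1 = ∑' n, ite (n = 1) (0 : ℂ) (LSeries.term 1 s n) := by
    rw [← LSeries_one_eq_riemannZeta hs, LSeries, hsumf.tsum_eq_add_tsum_ite 1, ht1]
    ring
  have hsum1' : Summable fun n => ite (n = 1) (0 : ℂ) (LSeries.term 1 (σ : ℂ) n) := by
    have h := hsum1.update 1 0
    refine h.congr fun n => ?_
    rw [Function.update_apply]
  have hζσ : (riemannZeta (σ : ℂ)).re - 1 =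
      ∑' n, (ite (n = 1) (0 : ℂ) (LSeries.term 1 (σ : ℂ) n)).re := by
    have h1 : riemannZeta (σ : ℂ) = 1 + ∑' n, ite (n = 1) (0 : ℂ) (LSeries.term 1 (σ : ℂ) n) := by
      rw [← LSeries_one_eq_riemannZeta hσ, LSeries, hsum1.tsum_eq_add_tsum_ite 1, ht1]
    rw [h1, Complex.add_re, Complex.one_re, Complex.re_tsum hsum1']
    ring
  -- termwise comparison
  have hterm : ∀ n, ‖ite (n = 1) (0 : ℂ) (LSeries.term 1 s n)‖ ≤
      (ite (n = 1) (0 : ℂ) (LSeries.term 1 (σ : ℂ) n)).re := by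
    intro n
    split_ifs with h
    · simp
    rcases eq_or_ne n 0 with rfl | hn
    · simp
    rw [LSeries.norm_term_eq, if_neg hn, LSeries.term_of_ne_zero hn]
    simp only [Pi.one_apply, norm_one]
    have : (n : ℂ) ^ (σ : ℂ) = ((n : ℝ) ^ σ : ℝ) := by
      rw [Complex.ofReal_cpow (Nat.cast_nonneg n)]; simp
    rw [this, show (1 : ℂ) = ((1 : ℝ) : ℂ) from rfl, ← Complex.ofReal_div, Complex.ofReal_re]
  have hsumn : Summable fun n => ‖ite (n = 1) (0 : ℂ) (LSeries.term 1 s n)‖ := by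
    refine Summable.of_nonneg_of_le (fun n => norm_nonneg _) (fun n => ?_) hsumf.norm
    split_ifs with h
    · simp
    · exact le_rfl
  have hsumre : Summable fun n => (ite (n = 1) (0 : ℂ) (LSeries.term 1 (σ : ℂ) n)).re :=
    (Complex.reCLM.summable hsum1')
  calc ‖riemannZeta s - 1‖ = ‖∑' n, ite (n = 1) (0 : ℂ) (LSeries.term 1 s n)‖ := by rw [hζ]
    _ ≤ ∑' n, ‖ite (n = 1) (0 : ℂ) (LSeries.term 1 s n)‖ := norm_tsum_le_tsum_norm hsumn
    _ ≤ ∑' n, (ite (n = 1) (0 : ℂ) (LSeries.term 1 (σ : ℂ) n)).re :=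
        Summable.tsum_le_tsum hterm hsumn hsumre
    _ = (riemannZeta (σ : ℂ)).re - 1 := hζσ.symm

/-- **`‖ζ(s) − 1‖ ≤ ‖ζ(σ)‖ − 1` for `σ = Re s > 1`.** [cite: Titchmarsh1986, §1.1 eq. (1.1.1)] -/
theorem norm_riemannZeta_sub_one_le_norm_sub_one {s : ℂ} (hs : 1 < s.re) :
    ‖riemannZeta s - 1‖ ≤ ‖riemannZeta (s.re : ℂ)‖ - 1 :=
  (norm_riemannZeta_sub_one_le_re_sub_one hs).trans (sub_le_sub_right (Complex.re_le_norm _) 1)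

/-- **Vertical-line form:** for real `σ > 1` and every real `t`,
`‖ζ(σ + it) − 1‖ ≤ ‖ζ(σ)‖ − 1` (the cell rh-jensen shape `ZetaSubOneVerticalSup`).
[cite: Titchmarsh1986, §1.1 eq. (1.1.1)] -/
theorem norm_riemannZeta_vertical_sub_one_le (σ t : ℝ) (hσ : 1 < σ) :
    ‖riemannZeta ((σ : ℂ) + t * Complex.I) - 1‖ ≤ ‖riemannZeta (σ : ℂ)‖ - 1 := by
  have h := norm_riemannZeta_sub_one_le_norm_sub_one (s := (σ : ℂ) + t * Complex.I) (by simp [hσ])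
  simpa using h

/-- The same, in the `∀ σ t` packaging of the cell's statement `ZetaSubOneVerticalSup`.
[cite: Titchmarsh1986, §1.1 eq. (1.1.1)] -/
theorem zetaSubOneVerticalSup :
    ∀ σ t : ℝ, 1 < σ → ‖riemannZeta ((σ : ℂ) + t * Complex.I) - 1‖ ≤ ‖riemannZeta (σ : ℂ)‖ - 1 :=
  fun σ t hσ => norm_riemannZeta_vertical_sub_one_le σ t hσ

end Literature.NumberTheory.LFunctions
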